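import Mathlib
import Summits.CriticalPhenomena.SAWScalingLimit.Theorems.SAWRestrictionRigidityAxiomsOfLimitKernelClauseMarkovExtensionAEM
import Summits.CriticalPhenomena.SAWScalingLimit.Theorems.SAWRestrictionRigidityAxiomsOfLimitKernelClauseSoftMarkovAEM
import Summits.CriticalPhenomena.SAWScalingLimit.Theorems.SAWRestrictionRigidityAxiomsOfLimitKernelClauseAEUniqueAEM
import Summits.CriticalPhenomena.SAWScalingLimit.Theorems.SAWRestrictionRigidityAxiomsOfLimitMarkovSoftMarkovPath
import Literature.Probability.RandomPlanarGeometry.SAWScalingLimitFamily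
import Literature.Probability.RandomPlanarGeometry.ChordalRestrictionMarkov
import HarnessLib

/-!
# The Markov conjunct of `AxiomsOfLimit` reduced to a kernel-free, per-stopping-set statement

Crux `AxiomsOfLimit` (stmt-CriticalPhenomena-1370), line `registered`, stub `stub_kernelClauseAE`
(lead c5, capstone of wave 2). Theorems only.

* `isMarkovExtension_aem_of_isScalingLimitFamily`: every chordal full scaling limit `P` of the
  critical `δℤ²` SAW carried by simple boundary-avoiding curves (conjunct (vi)) admits a Markov
  extension `Q` (`initial`, `markov` for every closed `F`, `domain`) whose kernel read at the past
  `γ.stopAt F` is, for every `D`, closed `F` and measurable `T`, `P D`-a.e. a MEASURABLE function of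
  the past ("AEM"). Composition of the AEM soft-Markov theorem (`stub_softMarkovAllF_aem`,
  discharged by the path-level theorem `stub_softMarkovPathLevel`) with the AEM configuration
  packaging (`stub_isMarkovExtensionOfSoft_aem`) and `IsScalingLimitFamily.apply_eq_of_carrier_eq`.
* `kernelClauseAE_of_perF`: by a.e. uniqueness of AEM Markov kernels
  (`stub_markovKernelAEUnique_aem`), the a.e. restriction-kernel clause for SOME Markov extension of
  `P` — the registered stub `stub_kernelClauseAE` of the crux skeleton — follows from a statement
  that mentions no Markov extension at all: for every Dobrushin `D` and closed `F` separately, ANY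
  kernel `q` disintegrating `P D` at `F` with the AEM property (e.g. a regular conditional
  distribution of the future given the past) satisfies the clause at `P D`-a.e. past. This is the
  weakest form of the research residual of the Markov conjunct: a property of the two-piece
  decomposition of the single law `P D` at the single stopping set `F`.

References: W. Werner (2007) §3.2 (2); G. F. Lawler, O. Schramm, W. Werner, *Conformal
restriction: the chordal case* (2003) §3; O. Kallenberg, *Foundations of Modern Probability*
(3rd ed.) Thm 8.5 (uniqueness of disintegration). All [folklore].
-/

noncomputable section

open MeasureTheory Filter Set
open scoped ENNReal

namespace Summit.CriticalPhenomena.SAWScalingLimit.Theorems.AxiomsOfLimitKernelClause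

open Literature.Probability.RandomPlanarGeometry
open Summit.CriticalPhenomena.SAWScalingLimit.Theorems.AxiomsOfLimitMarkov

/-- **AEM Markov extension of simple chordal families with carrier-dependent laws**: all three
clauses of `IsMarkovExtension` plus the a.e.-measurability of the kernel read at the past, for
every `D`, closed `F` and measurable `T`. [folklore] -/
theorem isMarkovExtension_aem_of_isChordal_of_simple (P : ChordalFamily) (hch : P.IsChordal)
    (h6 : ∀ D : DobrushinDomain, ∀ᵐ γ ∂(P D), γ ∈ CurveClass.simple ∧ γ.range ∩ frontier D.carrier ⊆ {D.pt 0, D.pt 1})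
    (hdep : ∀ D D' : DobrushinDomain, D.carrier = D'.carrier → D.pt 0 = D'.pt 0 → D.pt 1 = D'.pt 1 → P D = P D') :
    ∃ Q : DobrushinDomain → CurveClass ℂ → Measure (CurveClass ℂ), P.IsMarkovExtension Q ∧
      ∀ (D : DobrushinDomain) (F : Set ℂ), IsClosed F → ∀ T : Set (CurveClass ℂ), MeasurableSet T →
        ∃ φ : CurveClass ℂ → ℝ≥0∞, Measurable φ ∧ ∀ᵐ γ ∂(P D), Q D (γ.stopAt F) T = φ (γ.stopAt F) :=
  stub_isMarkovExtensionOfSoft_aem (stub_softMarkovAllF_aem stub_softMarkovPathLevel) P hch h6 hdep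

/-- **AEM Markov extension of every full SAW scaling limit carried by simple boundary-avoiding
curves** (registered sub-goal `stub_isMarkovExtensionAEMOfScalingLimit`, notation-free). [folklore] -/
theorem stub_isMarkovExtensionAEMOfScalingLimit : ∀ P : Literature.Probability.RandomPlanarGeometry.ChordalFamily, P.IsChordal → (∀ (D : Literature.Probability.RandomPlanarGeometry.DobrushinDomain) (a b : ℝ → Literature.Probability.LatticeModels.Site 2), Literature.Probability.RandomPlanarGeometry.SAW.IsEndpointApprox D a b → Literature.Probability.RandomPlanarGeometry.TendstoLaw (fun δ (γ : Literature.Probability.RandomPlanarGeometry.SAW.DomainSAW D.carrier δ (a δ) (b δ)) => γ.curve) (fun δ => Literature.Probability.RandomPlanarGeometry.SAW.law D.carrier δ (a δ) (b δ)) id (P D)) → (∀ D : Literature.Probability.RandomPlanarGeometry.DobrushinDomain, ∀ᵐ γ ∂(P D), γ ∈ Literature.Probability.RandomPlanarGeometry.CurveClass.simple ∧ γ.range ∩ frontier D.carrier ⊆ {D.pt 0, D.pt 1}) → ∃ Q : Literature.Probability.RandomPlanarGeometry.DobrushinDomain → Literature.Probability.RandomPlanarGeometry.CurveClass ℂ →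 MeasureTheory.Measure (Literature.Probability.RandomPlanarGeometry.CurveClass ℂ), P.IsMarkovExtension Q ∧ ∀ (D : Literature.Probability.RandomPlanarGeometry.DobrushinDomain) (F : Set ℂ), IsClosed F → ∀ T : Set (Literature.Probability.RandomPlanarGeometry.CurveClass ℂ), MeasurableSet T → ∃ φ : Literature.Probability.RandomPlanarGeometry.CurveClass ℂ → ENNReal, Measurable φ ∧ Filter.Eventually (fun γ : Literature.Probability.RandomPlanarGeometry.CurveClass ℂ => Q D (γ.stopAt F) T = φ (γ.stopAt F)) (MeasureTheory.ae (P D)) := by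
  intro P hch hlim h6
  have hP : SAW.IsScalingLimitFamily P := ⟨hch, hlim⟩
  exact isMarkovExtension_aem_of_isChordal_of_simple P hch h6 fun D D' hc h0 h1 =>
    hP.apply_eq_of_carrier_eq hc h0 h1

/-- **Transfer of the a.e. kernel clause between a.e.-equal kernels** at one `(D, F)`. [folklore] -/
theorem kernelClauseAE_congr {P : ChordalFamily} {D : DobrushinDomain} {F : Set ℂ}
    {q₁ q₂ : CurveClass ℂ → Measure (CurveClass ℂ)}
    (heq : ∀ᵐ γ ∂(P D), q₁ (γ.stopAt F) = q₂ (γ.stopAt F))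
    (h₁ : ∀ᵐ γ ∂(P D), ∀ D' : DobrushinDomain, D'.carrier ⊆ remainingDomain D (γ.stopAt F) →
      D'.pt 0 = (γ.stopAt F).target → D'.pt 1 = D.pt 1 → ∀ T : Set (CurveClass ℂ), MeasurableSet T →
        P D' T * q₁ (γ.stopAt F) (CurveClass.rangeSubset (closure D'.carrier)) =
          q₁ (γ.stopAt F) (T ∩ CurveClass.rangeSubset (closure D'.carrier))) :
    ∀ᵐ γ ∂(P D), ∀ D' : DobrushinDomain, D'.carrier ⊆ remainingDomain D (γ.stopAt F) →
      D'.pt 0 = (γ.stopAt F).target → D'.pt 1 = D.pt 1 → ∀ T : Set (CurveClass ℂ), MeasurableSet T →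
        P D' T * q₂ (γ.stopAt F) (CurveClass.rangeSubset (closure D'.carrier)) =
          q₂ (γ.stopAt F) (T ∩ CurveClass.rangeSubset (closure D'.carrier)) := by
  filter_upwards [heq, h₁] with γ hγ h D' hsub h0 h1 T hT
  rw [← hγ]
  exact h D' hsub h0 h1 T hT

/-- **The a.e. kernel clause from its kernel-free, per-stopping-set form.** Let `P` be a chordal
full SAW scaling limit with the restriction property, carried by simple boundary-avoiding curves.
Suppose that for every Dobrushin `D` and closed `F` there is SOME kernel `q` disintegrating `P D` at
`F` (`P D (stopAt F ⁻¹' S ∩ startFrom F ⁻¹' T) = ∫⁻ γ in stopAt F ⁻¹' S, q (γ.stopAt F) T ∂P D`),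
a.e. equal at the past to a measurable function of the past for each measurable `T`, and
satisfying the restriction-kernel clause at `P D`-a.e. past. Then the AEM Markov extension `Q` of
`P` agrees with `q` at `P D`-a.e. past (a.e. uniqueness of disintegrations), so `Q` satisfies the
a.e. clause for every `D` and every closed `F`: the conclusion of the crux skeleton's
`stub_kernelClauseAE`. (The restriction hypothesis is not used here; it is kept so that the statement
is literally `stub_kernelClausePerF → stub_kernelClauseAE` of the skeleton.) [folklore] -/
theorem stub_kernelClauseAEOfPerF : ∀ P : Literature.Probability.RandomPlanarGeometry.ChordalFamily, P.IsChordal → (∀ (D : Literature.Probability.RandomPlanarGeometry.DobrushinDomain) (a b : ℝ → Literature.Probability.LatticeModels.Site 2), Literature.Probability.RandomPlanarGeometry.SAW.IsEndpointApprox D a b → Literature.Probability.RandomPlanarGeometry.TendstoLaw (fun δ (γ : Literature.Probability.RandomPlanarGeometry.SAW.DomainSAW D.carrier δ (a δ) (b δ)) => γ.curve) (fun δ => Literature.Probability.RandomPlanarGeometry.SAW.law D.carrier δ (a δ) (b δ)) id (P D)) → P.IsRestriction → (∀ D : Literature.Probability.RandomPlanarGeometry.DobrushinDomain, ∀ᵐ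 γ ∂(P D), γ ∈ Literature.Probability.RandomPlanarGeometry.CurveClass.simple ∧ γ.range ∩ frontier D.carrier ⊆ {D.pt 0, D.pt 1}) → (∀ (D : Literature.Probability.RandomPlanarGeometry.DobrushinDomain) (F : Set ℂ), IsClosed F → ∃ q : Literature.Probability.RandomPlanarGeometry.CurveClass ℂ → MeasureTheory.Measure (Literature.Probability.RandomPlanarGeometry.CurveClass ℂ), (∀ T : Set (Literature.Probability.RandomPlanarGeometry.CurveClass ℂ), MeasurableSet T → ∃ φ : Literature.Probability.RandomPlanarGeometry.CurveClass ℂ → ENNReal, Measurable φ ∧ Filter.Eventually (fun γ : Literature.Probability.RandomPlanarGeometry.CurveClass ℂ => q (γ.stopAt F) T = φ (γ.stopAt F)) (MeasureTheory.ae (P D))) ∧ (∀ S T : Set (Literature.Probability.RandomPlanarGeometry.CurveClass ℂ), MeasurableSet S → MeasurableSet T → P D (Literature.Probability.RandomPlanarGeometry.CurveClass.stopAt F ⁻¹' S ∩ Literature.Probability.RandomPlanarGeometry.CurveClass.startFrom F ⁻¹' T) = MeasureTheory.lintegral ((P D).restrict (Literature.Probability.RandomPlanarGeometry.CurveClass.stopAt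 F ⁻¹' S)) (fun γ => q (γ.stopAt F) T)) ∧ Filter.Eventually (fun γ : Literature.Probability.RandomPlanarGeometry.CurveClass ℂ => ∀ D' : Literature.Probability.RandomPlanarGeometry.DobrushinDomain, D'.carrier ⊆ Literature.Probability.RandomPlanarGeometry.remainingDomain D (γ.stopAt F) → D'.pt 0 = (γ.stopAt F).target → D'.pt 1 = D.pt 1 → ∀ T : Set (Literature.Probability.RandomPlanarGeometry.CurveClass ℂ), MeasurableSet T → P D' T * q (γ.stopAt F) (Literature.Probability.RandomPlanarGeometry.CurveClass.rangeSubset (closure D'.carrier)) = q (γ.stopAt F) (T ∩ Literature.Probability.RandomPlanarGeometry.CurveClass.rangeSubset (closure D'.carrier))) (MeasureTheory.ae (P D))) → ∃ Q : Literature.Probability.RandomPlanarGeometry.DobrushinDomain → Literature.Probability.RandomPlanarGeometry.CurveClass ℂ → MeasureTheory.Measure (Literature.Probability.RandomPlanarGeometry.CurveClass ℂ), P.IsMarkovExtension Q ∧ ∀ (D : Literature.Probability.RandomPlanarGeometry.DobrushinDomain) (F : Set ℂ), IsClosed F → Filter.Eventually (fun γ : Literature.Probability.RandomPlanarGeometry.CurveClass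 ℂ => ∀ D' : Literature.Probability.RandomPlanarGeometry.DobrushinDomain, D'.carrier ⊆ Literature.Probability.RandomPlanarGeometry.remainingDomain D (γ.stopAt F) → D'.pt 0 = (γ.stopAt F).target → D'.pt 1 = D.pt 1 → ∀ T : Set (Literature.Probability.RandomPlanarGeometry.CurveClass ℂ), MeasurableSet T → P D' T * Q D (γ.stopAt F) (Literature.Probability.RandomPlanarGeometry.CurveClass.rangeSubset (closure D'.carrier)) = Q D (γ.stopAt F) (T ∩ Literature.Probability.RandomPlanarGeometry.CurveClass.rangeSubset (closure D'.carrier))) (MeasureTheory.ae (P D)) := by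
  intro P hch hlim _hR h6 hperF
  obtain ⟨Q, hQ, hQaem⟩ := stub_isMarkovExtensionAEMOfScalingLimit P hch hlim h6
  refine ⟨Q, hQ, fun D F hF => ?_⟩
  haveI : IsProbabilityMeasure (P D) := (hch D).1
  obtain ⟨q, hqaem, hqdis, hqcl⟩ := hperF D F hF
  have heq : ∀ᵐ γ ∂(P D), q (γ.stopAt F) = Q D (γ.stopAt F) :=
    stub_markovKernelAEUnique_aem (P D) F hF q (Q D) hqaem (hQaem D F hF) hqdis
      (fun S T hS hT => hQ.markov D F hF S T hS hT)
  exact kernelClauseAE_congr heq hqcl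

end Summit.CriticalPhenomena.SAWScalingLimit.Theorems.AxiomsOfLimitKernelClause

end
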